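import Literature.Geometry.Lorentzian.StationaryOrbitRelation
import Literature.Geometry.Lorentzian.StationaryBlackHoleUniquenessProofs
import HarnessLib

/-!
# Flow-invariant sets: integral-curve form versus flow-map form, saturation, openness

A subset `C ⊆ M` is **invariant** under a vector field `V` when every whole-line integral curve of
`V` starting in `C` stays in `C` — the form in which invariance is written throughout the Lorentz
prelude (`M_ext`, `⟨⟨M_ext⟩⟩`, `𝓔⁺` are invariant under the stationary Killing field:
`mem_doc_of_isMIntegralCurve`, `mem_horizon_of_isMIntegralCurve`; Chruściel–Costa 2008, §2.2) and
in which the stationary-rigidity cruxes phrase "`U₁ ∩ ⟨⟨M_ext⟩⟩` is a union of orbits".  This file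
relates it to the two other standard forms — invariance under the flow maps `θₜ` of a flow `θ` of
`V`, and being a fixed point of the saturation `C ↦ ⋃ₜ φₜ(C) = stationaryOrbit V C` — and records
the set algebra and the openness of saturations:

* `image_flow_eq_of_forall_isMIntegralCurve`, `flow_mem_iff_of_forall_isMIntegralCurve` —
  **curve-invariant ⇒ `θₜ(C) = C`** for any flow `θ` of `V` with the group law (no regularity);
* `forall_isMIntegralCurve_mem_of_forall_flow_mem` — **`θₜ(C) ⊆ C` for all `t` ⇒ curve-invariant**,
  for a `C¹` field on a Hausdorff manifold without boundary (integral curves are flow lines,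
  `eq_flow_of_isMIntegralCurve`);
* `stationaryOrbit_subset_iff_forall_isMIntegralCurve`, `stationaryOrbit_eq_self_iff` —
  **`⋃ₜ φₜ(C) ⊆ C` iff `C` is curve-invariant**, and `= C` iff moreover every point of `C` lies on a
  whole-line integral curve (e.g. `V` complete);
* `forall_isMIntegralCurve_mem_inter` / `_compl` / `_iUnion` / `_sUnion` — intersections,
  complements and unions of invariant sets are invariant;
* `isOpen_stationaryOrbit` — **the saturation `⋃ₜ φₜ(U)` of an open set is open** (`C¹` field with
  a continuous flow; each `θₜ` is a homeomorphism, `isOpen_iUnion_image_flow`), and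
  `StationaryAFBlackHole.isOpen_stationaryOrbit_killing` — for the stationary Killing field of a
  stationary asymptotically flat black hole (`exists_stationary_flow`).

Everything is proved; no definitions, no named facts.

## References

* P. T. Chruściel, J. L. Costa, *On uniqueness of stationary vacuum black holes*, Astérisque 321
  (2008) 195–265, arXiv:0806.0016, §2.2 (`M_ext = ⋃ₜ φₜ(Σ_ext)`, invariance of `⟨⟨M_ext⟩⟩`, `𝓔^±`)
  (key `ChruscielCosta2008`).
* J. M. Lee, *Introduction to Smooth Manifolds*, 2nd ed., GTM 218 (2012), Thm. 9.12 (flows of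
  complete fields; integral curves are flow lines) (key `LeeSmoothManifolds2013`).
-/

noncomputable section

open Bundle Set Function Filter Manifold
open scoped Manifold ContDiff Topology

namespace Literature.Geometry.Lorentzian

universe u

variable {E : Type*} [NormedAddCommGroup E] [NormedSpace ℝ E] {H : Type*} [TopologicalSpace H]
  {I : ModelWithCorners ℝ E H} {M : Type*} [TopologicalSpace M] [ChartedSpace H M]
  {V : Π x : M, TangentSpace I x}

/-! ### Curve-invariance and the flow maps -/

section Flow

variable {θ : ℝ × M → M}

/-- **A curve-invariant set is invariant under every flow map**: if every integral curve of `V`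
starting in `C` stays in `C`, then `θₜ(C) = C` for any flow `θ` of `V` (`θ(0, ·) = id`, group law,
`t ↦ θ(t, p)` integral curves).  `⊆`: `θ(t, c)` lies on the integral curve through `c`; `⊇`:
`c = θₜ(θ₋ₜ c)` with `θ₋ₜ c ∈ C` likewise. Chruściel–Costa 2008, §2.2. [folklore] -/
theorem image_flow_eq_of_forall_isMIntegralCurve (hθ0 : ∀ p, θ (0, p) = p)
    (hθadd : ∀ t s p, θ (t, θ (s, p)) = θ (t + s, p))
    (hθX : ∀ p, IsMIntegralCurve (fun t ↦ θ (t, p)) V) {C : Set M}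
    (hC : ∀ γ : ℝ → M, IsMIntegralCurve γ V → γ 0 ∈ C → ∀ t, γ t ∈ C) (t : ℝ) :
    (fun q ↦ θ (t, q)) '' C = C := by
  ext c
  constructor
  · rintro ⟨c', hc', rfl⟩
    exact hC _ (hθX c') (by simpa only [hθ0] using hc') t
  · intro hc
    exact ⟨θ (-t, c), hC _ (hθX c) (by simpa only [hθ0] using hc) (-t),
      flow_apply_flow_neg hθ0 hθadd t c⟩

/-- Pointwise form: for a curve-invariant `C` and any flow of `V` with the group law,
`θ(t, p) ∈ C ↔ p ∈ C`. [folklore] -/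
theorem flow_mem_iff_of_forall_isMIntegralCurve (hθ0 : ∀ p, θ (0, p) = p)
    (hθadd : ∀ t s p, θ (t, θ (s, p)) = θ (t + s, p))
    (hθX : ∀ p, IsMIntegralCurve (fun t ↦ θ (t, p)) V) {C : Set M}
    (hC : ∀ γ : ℝ → M, IsMIntegralCurve γ V → γ 0 ∈ C → ∀ t, γ t ∈ C) (t : ℝ) (p : M) :
    θ (t, p) ∈ C ↔ p ∈ C := by
  constructor
  · intro h
    have h' := hC _ (hθX (θ (t, p))) (by simpa only [hθ0] using h) (-t)
    simpa only [flow_neg_apply_flow hθ0 hθadd] using h'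
  · intro hp
    exact hC _ (hθX p) (by simpa only [hθ0] using hp) t

/-- **Invariance under the flow maps implies curve-invariance** for a `C¹` field on a Hausdorff
manifold without boundary: every integral curve is a flow line, `γ t = θ(t, γ 0)`
(`eq_flow_of_isMIntegralCurve`, Lee 2012, Thm. 9.12 (a)), so `θₜ(C) ⊆ C` for all `t` gives
`γ t ∈ C`. [cite: LeeSmoothManifolds2013, Thm. 9.12 (a)] -/
theorem forall_isMIntegralCurve_mem_of_forall_flow_mem [IsManifold I ∞ M] [T2Space M]
    [BoundarylessManifold I M]
    (hV : CMDiff 1 (T% V)) (hθX : ∀ p, IsMIntegralCurve (fun t ↦ θ (t, p)) V)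
    (hθ0 : ∀ p, θ (0, p) = p) {C : Set M} (hC : ∀ t, ∀ p ∈ C, θ (t, p) ∈ C)
    (γ : ℝ → M) (hγ : IsMIntegralCurve γ V) (hγ0 : γ 0 ∈ C) (t : ℝ) : γ t ∈ C := by
  rw [eq_flow_of_isMIntegralCurve hV hθX hθ0 hγ t]
  exact hC t _ hγ0

end Flow

/-! ### Curve-invariance and the saturation `⋃ₜ φₜ(C)` -/

/-- **`⋃ₜ φₜ(C) ⊆ C` iff `C` is curve-invariant** (by the definition of `stationaryOrbit` as the
union of the whole-line integral curves from `C`; no regularity or completeness). [folklore] -/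
theorem stationaryOrbit_subset_iff_forall_isMIntegralCurve {C : Set M} :
    stationaryOrbit V C ⊆ C ↔
      ∀ γ : ℝ → M, IsMIntegralCurve γ V → γ 0 ∈ C → ∀ t, γ t ∈ C := by
  constructor
  · intro h γ hγ hγ0 t
    exact h ⟨γ, hγ, hγ0, t, rfl⟩
  · rintro h _ ⟨γ, hγ, hγ0, t, rfl⟩
    exact h γ hγ hγ0 t

/-- **`⋃ₜ φₜ(C) = C` iff `C` is curve-invariant and every point of `C` lies on a whole-line
integral curve of `V`** (the latter holds for all `C` when `V` is complete,
`IsCompleteVectorField`). [folklore] -/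
theorem stationaryOrbit_eq_self_iff {C : Set M} :
    stationaryOrbit V C = C ↔
      (∀ γ : ℝ → M, IsMIntegralCurve γ V → γ 0 ∈ C → ∀ t, γ t ∈ C) ∧
        ∀ x ∈ C, ∃ γ : ℝ → M, IsMIntegralCurve γ V ∧ γ 0 = x := by
  constructor
  · intro h
    refine ⟨stationaryOrbit_subset_iff_forall_isMIntegralCurve.1 h.subset, fun x hx ↦ ?_⟩
    obtain ⟨γ, hγ, hγ0, t, rfl⟩ := h.symm.subset hx
    exact ⟨γ ∘ (· + t), hγ.comp_add t, by simp⟩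
  · rintro ⟨hinv, hcurve⟩
    refine Subset.antisymm (stationaryOrbit_subset_iff_forall_isMIntegralCurve.2 hinv) fun x hx ↦ ?_
    obtain ⟨γ, hγ, rfl⟩ := hcurve x hx
    exact ⟨γ, hγ, hx, 0, rfl⟩

/-- A curve-invariant set is its own saturation when the field is complete. Chruściel–Costa 2008,
§2.2 (`M_ext`, `⟨⟨M_ext⟩⟩` are unions of complete orbits). [folklore] -/
theorem stationaryOrbit_eq_self_of_forall_isMIntegralCurve (hV : IsCompleteVectorField V) {C : Set M}
    (hC : ∀ γ : ℝ → M, IsMIntegralCurve γ V → γ 0 ∈ C → ∀ t, γ t ∈ C) :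
    stationaryOrbit V C = C :=
  stationaryOrbit_eq_self_iff.2 ⟨hC, fun x _ ↦ hV x⟩

/-! ### Set algebra of invariant sets -/

/-- Intersections of curve-invariant sets are curve-invariant. [folklore] -/
theorem forall_isMIntegralCurve_mem_inter {A B : Set M}
    (hA : ∀ γ : ℝ → M, IsMIntegralCurve γ V → γ 0 ∈ A → ∀ t, γ t ∈ A)
    (hB : ∀ γ : ℝ → M, IsMIntegralCurve γ V → γ 0 ∈ B → ∀ t, γ t ∈ B)
    (γ : ℝ → M) (hγ : IsMIntegralCurve γ V) (hγ0 : γ 0 ∈ A ∩ B) (t : ℝ) : γ t ∈ A ∩ B :=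
  ⟨hA γ hγ hγ0.1 t, hB γ hγ hγ0.2 t⟩

/-- Complements of curve-invariant sets are curve-invariant (reparametrise: if `γ t ∈ A` then
`γ 0 = (γ ∘ (· + t)) (-t) ∈ A`). [folklore] -/
theorem forall_isMIntegralCurve_mem_compl {A : Set M}
    (hA : ∀ γ : ℝ → M, IsMIntegralCurve γ V → γ 0 ∈ A → ∀ t, γ t ∈ A)
    (γ : ℝ → M) (hγ : IsMIntegralCurve γ V) (hγ0 : γ 0 ∈ Aᶜ) (t : ℝ) : γ t ∈ Aᶜ := by
  intro ht
  apply hγ0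
  have h := hA (γ ∘ (· + t)) (hγ.comp_add t) (by simpa using ht) (-t)
  simpa using h

/-- Indexed unions of curve-invariant sets are curve-invariant. [folklore] -/
theorem forall_isMIntegralCurve_mem_iUnion {ι : Sort*} {A : ι → Set M}
    (hA : ∀ i, ∀ γ : ℝ → M, IsMIntegralCurve γ V → γ 0 ∈ A i → ∀ t, γ t ∈ A i)
    (γ : ℝ → M) (hγ : IsMIntegralCurve γ V) (hγ0 : γ 0 ∈ ⋃ i, A i) (t : ℝ) : γ t ∈ ⋃ i, A i := by
  obtain ⟨i, hi⟩ := mem_iUnion.1 hγ0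
  exact mem_iUnion.2 ⟨i, hA i γ hγ hi t⟩

/-- Unions of families of curve-invariant sets are curve-invariant. [folklore] -/
theorem forall_isMIntegralCurve_mem_sUnion {𝒜 : Set (Set M)}
    (hA : ∀ A ∈ 𝒜, ∀ γ : ℝ → M, IsMIntegralCurve γ V → γ 0 ∈ A → ∀ t, γ t ∈ A)
    (γ : ℝ → M) (hγ : IsMIntegralCurve γ V) (hγ0 : γ 0 ∈ ⋃₀ 𝒜) (t : ℝ) : γ t ∈ ⋃₀ 𝒜 := by
  obtain ⟨A, hA𝒜, hA0⟩ := mem_sUnion.1 hγ0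
  exact mem_sUnion.2 ⟨A, hA𝒜, hA A hA𝒜 γ hγ hA0 t⟩

/-- The saturation `⋃ₜ φₜ(C)` of any set is curve-invariant, for a `C¹` field on a Hausdorff manifold
without boundary (an integral curve starting on the curve `γ` from `C` is a time-translate of `γ`,
`mem_stationaryOrbit_of_isMIntegralCurve_of_mem`). Chruściel–Costa 2008, §2.2. [folklore] -/
theorem forall_isMIntegralCurve_mem_stationaryOrbit [IsManifold I ∞ M] [T2Space M]
    [BoundarylessManifold I M] (hV : CMDiff 1 (T% V)) (C : Set M) (γ : ℝ → M)
    (hγ : IsMIntegralCurve γ V) (hγ0 : γ 0 ∈ stationaryOrbit V C) (t : ℝ) :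
    γ t ∈ stationaryOrbit V C :=
  mem_stationaryOrbit_of_isMIntegralCurve_of_mem hV hγ hγ0 t

/-! ### Saturations of open sets are open -/

/-- **The saturation `⋃ₜ φₜ(U)` of an open set is open**, for a `C¹` field with a continuous flow
with the group law on a Hausdorff manifold without boundary: it is `⋃ₜ θₜ(U)`
(`stationaryOrbit_eq_iUnion_image_flow`) and each `θₜ` is a homeomorphism
(`isOpen_iUnion_image_flow`).  This is the openness of the orbit-space projection (Anderson 2000,
§0) and the way flow-invariant open neighbourhoods `⋃ₜ φₜ(W)` of an invariant set are produced.
[folklore] -/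
theorem isOpen_stationaryOrbit [IsManifold I ∞ M] [T2Space M] [BoundarylessManifold I M]
    {θ : ℝ × M → M} (hV : CMDiff 1 (T% V)) (hθc : Continuous θ)
    (hθX : ∀ p, IsMIntegralCurve (fun t ↦ θ (t, p)) V) (hθ0 : ∀ p, θ (0, p) = p)
    (hθadd : ∀ t s p, θ (t, θ (s, p)) = θ (t + s, p)) {U : Set M} (hU : IsOpen U) :
    IsOpen (stationaryOrbit V U) := by
  rw [stationaryOrbit_eq_iUnion_image_flow hV hθX hθ0]
  exact isOpen_iUnion_image_flow hθc hθ0 hθadd hU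

namespace StationaryAFBlackHole

variable (𝓑 : StationaryAFBlackHole.{u}) [𝓑.metric.HasLeviCivita]

/-- **The saturation `⋃ₜ φₜ(U)` of an open set under the stationary Killing flow of a stationary
asymptotically flat black hole is open** (`exists_stationary_flow` provides the smooth global flow).
Chruściel–Costa 2008, §2.2 (`φₜ[X]`). [cite: ChruscielCosta2008, §2.2] -/
theorem isOpen_stationaryOrbit_killing {U : Set 𝓑.carrier} (hU : IsOpen U) :
    IsOpen (stationaryOrbit 𝓑.killing U) := by
  obtain ⟨θ, hθ, hθ0, hθadd, hθX, -⟩ := 𝓑.exists_stationary_flow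
  have hK1 : ContMDiff (𝓡 4) (𝓡 4).tangent 1
      (fun x ↦ (⟨x, 𝓑.killing x⟩ : TangentBundle (𝓡 4) 𝓑.carrier)) :=
    𝓑.isStationaryKilling.isKillingField.contMDiff.of_le (WithTop.coe_le_coe.mpr le_top)
  exact isOpen_stationaryOrbit hK1 hθ.continuous hθX hθ0 hθadd hU

/-- The saturation of any set under the stationary Killing flow is curve-invariant. Chruściel–Costa
2008, §2.2. [cite: ChruscielCosta2008, §2.2] -/
theorem forall_isMIntegralCurve_mem_stationaryOrbit_killing (C : Set 𝓑.carrier)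
    (γ : ℝ → 𝓑.carrier) (hγ : IsMIntegralCurve γ 𝓑.killing)
    (hγ0 : γ 0 ∈ stationaryOrbit 𝓑.killing C) (t : ℝ) : γ t ∈ stationaryOrbit 𝓑.killing C := by
  have hK1 : ContMDiff (𝓡 4) (𝓡 4).tangent 1
      (fun x ↦ (⟨x, 𝓑.killing x⟩ : TangentBundle (𝓡 4) 𝓑.carrier)) :=
    𝓑.isStationaryKilling.isKillingField.contMDiff.of_le (WithTop.coe_le_coe.mpr le_top)
  exact mem_stationaryOrbit_of_isMIntegralCurve_of_mem hK1 hγ hγ0 t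

/-- A curve-invariant set is its own saturation under the (complete) stationary Killing flow.
Chruściel–Costa 2008, §2.2. [cite: ChruscielCosta2008, §2.2] -/
theorem stationaryOrbit_killing_eq_self {C : Set 𝓑.carrier}
    (hC : ∀ γ : ℝ → 𝓑.carrier, IsMIntegralCurve γ 𝓑.killing → γ 0 ∈ C → ∀ t, γ t ∈ C) :
    stationaryOrbit 𝓑.killing C = C :=
  stationaryOrbit_eq_self_of_forall_isMIntegralCurve 𝓑.isStationaryKilling.isCompleteVectorField hC

end StationaryAFBlackHole

end Literature.Geometry.Lorentzian

end
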